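import Mathlib
import HarnessLib
import Summits.HubbardSuperconductivity.HubbardSuperconductivity.Theorems.KLProgrammeKLRegimeSplitCounterMap
import Summits.HubbardSuperconductivity.HubbardSuperconductivity.Theorems.KLProgrammeFermiSurfaceFST2Constants

/-!
# Route `KLProgramme`, crux K3 (stmt-HubbardSuperconductivity-19937) — the `symInterp` TOOLKIT, part 3: ALL-ORDER derivative bounds of a
# frame on momentum space from its coefficient weights,
# `‖D^j (evalM K)(q)‖ ≤ coeffNorm j K = Σ_{m,n} (1+m+n)^j |κ_{m,n}|`

Cell gate-hubbard-kl, seat p1b (g4).  The missing generic link between the data side and the slot side of the two-leg interface: the engine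
(`KLRegimeEngineV7/V8`, stmt-…-19662) must certify (E3a-G) `TwoLegSizesG` and (E3g) — bounds on `iteratedFDeriv ℝ j (evalM (klTwoLegPieceG …))`,
i.e. on derivatives of DIFFERENCES OF `symInterp`'S — from the position-space moments of its kernels; parts 1–2 (`…SplitSymInterp`,
`…SplitSymInterpBounds`) turn moments / k-differences into `coeffNorm r (symInterp L f) ≤ Σ_x (1+|x̃₀|+|x̃₁|)^r |f_c(x)|`; this part turns
`coeffNorm j` into the operator norm of the `j`-th Fréchet derivative on `Momentum = EuclideanSpace ℝ (Fin 2)`: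
* `norm_iteratedFDeriv_cos_coord_le`: `‖D^j (q ↦ cos(m·q_i))‖ ≤ m^j` (composition of `cos` with the linear form `m·proj_i`,
  `ContinuousLinearMap.iteratedFDeriv_comp_right` + `Real.abs_iteratedDeriv_cos_le_one` + fs-1's `klfs_norm_proj_le`);
* `norm_iteratedFDeriv_harmonicM_le`: `‖D^j h_{m,n}‖ ≤ (m+n)^j` (Leibniz bound `norm_iteratedFDeriv_mul_le` + the binomial theorem);
* **`norm_iteratedFDeriv_evalM_le_coeffNorm`**: `‖D^j (evalM K)(q)‖ ≤ coeffNorm j K` for every frame `K`, order `j` and point `q`;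
* `norm_iteratedFDeriv_evalM_fsub_le`: the same for a difference of frames through `coeffNorm j` of both.
Proofs only; nothing is asserted about the model.
-/

noncomputable section

namespace Summit.HubbardSuperconductivity.HubbardSuperconductivity.Theorems.KLRegimeSplit

set_option linter.dupNamespace false -- summit = problem name (single-conjunct summit), D-0017

open Real Finset Literature.MathematicalPhysics.QuantumLattice Literature.Probability.LatticeModels

/-! ## §1 Coordinates and cosines of coordinates -/

/-- The `i`-th coordinate of `Momentum` as a continuous linear form. -/
theorem coordCLM_apply (i : Fin 2) (q : Momentum) :
    (PiLp.proj 2 (fun _ : Fin 2 => ℝ) i : Momentum →L[ℝ] ℝ) q = (WithLp.ofLp q) i := rfl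

/-- **`‖D^j (q ↦ cos(m·qᵢ))‖ ≤ m^j`.** -/
theorem norm_iteratedFDeriv_cos_coord_le (m : ℕ) (i : Fin 2) (j : ℕ) (q : Momentum) :
    ‖iteratedFDeriv ℝ j (fun q : Momentum => Real.cos (m * (WithLp.ofLp q) i)) q‖ ≤ (m : ℝ) ^ j := by
  set Lf : Momentum →L[ℝ] ℝ := (m : ℝ) • (PiLp.proj 2 (fun _ : Fin 2 => ℝ) i : Momentum →L[ℝ] ℝ) with hLf
  have hfun : (fun q : Momentum => Real.cos (m * (WithLp.ofLp q) i)) = Real.cos ∘ Lf := by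
    funext q; simp [hLf]
  have hnL : ‖Lf‖ ≤ m := by
    rw [hLf, norm_smul, Real.norm_eq_abs, Nat.abs_cast]
    exact mul_le_of_le_one_right (Nat.cast_nonneg m) (Summit.HubbardSuperconductivity.HubbardSuperconductivity.Theorems.klfs_norm_proj_le i)
  rw [hfun, ContinuousLinearMap.iteratedFDeriv_comp_right Lf Real.contDiff_cos q (i := j) le_top]
  refine (ContinuousMultilinearMap.norm_compContinuousLinearMap_le _ _).trans ?_
  rw [Finset.prod_const, Finset.card_univ, Fintype.card_fin, norm_iteratedFDeriv_eq_norm_iteratedDeriv,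
    Real.norm_eq_abs]
  calc |iteratedDeriv j Real.cos (Lf q)| * ‖Lf‖ ^ j ≤ 1 * (m : ℝ) ^ j :=
        mul_le_mul (Real.abs_iteratedDeriv_cos_le_one j _) (pow_le_pow_left₀ (norm_nonneg _) hnL j)
          (by positivity) zero_le_one
    _ = (m : ℝ) ^ j := one_mul _

/-- The cosine of a multiple of a coordinate is smooth. -/
theorem contDiff_cos_coord (m : ℕ) (i : Fin 2) {k : WithTop ℕ∞} :
    ContDiff ℝ k (fun q : Momentum => Real.cos (m * (WithLp.ofLp q) i)) :=
  Real.contDiff_cos.comp (contDiff_const.mul (contDiff_coord i))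

/-! ## §2 The harmonics -/

/-- **`‖D^j (q ↦ cos(m·q_a)·cos(n·q_b))‖ ≤ (m+n)^j`** (Leibniz + binomial theorem). -/
theorem norm_iteratedFDeriv_cos_mul_cos_le (m n : ℕ) (a b : Fin 2) (j : ℕ) (q : Momentum) :
    ‖iteratedFDeriv ℝ j (fun q : Momentum => Real.cos (m * (WithLp.ofLp q) a) * Real.cos (n * (WithLp.ofLp q) b)) q‖ ≤
      ((m : ℝ) + n) ^ j := by
  have hf := contDiff_cos_coord m a (k := ((j : ℕ∞) : WithTop ℕ∞))
  have hg := contDiff_cos_coord n b (k := ((j : ℕ∞) : WithTop ℕ∞))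
  refine (norm_iteratedFDeriv_mul_le hf hg q le_rfl).trans ?_
  rw [add_pow]
  refine Finset.sum_le_sum fun k _ => ?_
  have h1 := norm_iteratedFDeriv_cos_coord_le m a k q
  have h2 := norm_iteratedFDeriv_cos_coord_le n b (j - k) q
  have hc : (0 : ℝ) ≤ (j.choose k : ℝ) := Nat.cast_nonneg _
  calc (j.choose k : ℝ) * ‖iteratedFDeriv ℝ k (fun q : Momentum => Real.cos (m * (WithLp.ofLp q) a)) q‖ *
        ‖iteratedFDeriv ℝ (j - k) (fun q : Momentum => Real.cos (n * (WithLp.ofLp q) b)) q‖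
      = (j.choose k : ℝ) * (‖iteratedFDeriv ℝ k (fun q : Momentum => Real.cos (m * (WithLp.ofLp q) a)) q‖ *
        ‖iteratedFDeriv ℝ (j - k) (fun q : Momentum => Real.cos (n * (WithLp.ofLp q) b)) q‖) := mul_assoc _ _ _
    _ ≤ (j.choose k : ℝ) * ((m : ℝ) ^ k * (n : ℝ) ^ (j - k)) :=
        mul_le_mul_of_nonneg_left (mul_le_mul h1 h2 (norm_nonneg _) (by positivity)) hc
    _ = (m : ℝ) ^ k * (n : ℝ) ^ (j - k) * (j.choose k : ℝ) := by ring

/-- **`‖D^j h_{m,n}‖ ≤ (m+n)^j`** for the symmetrised harmonic `h_{m,n}(q) = ½(cos(m q₀)cos(n q₁) + cos(n q₀)cos(m q₁))`. -/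
theorem norm_iteratedFDeriv_harmonicM_le (m n : ℕ) (j : ℕ) (q : Momentum) :
    ‖iteratedFDeriv ℝ j (fun q : Momentum => TrigPolyC4v.harmonic m n (WithLp.ofLp q)) q‖ ≤ ((m : ℝ) + n) ^ j := by
  have hF := ((contDiff_cos_coord m 0).mul (contDiff_cos_coord n 1) :
    ContDiff ℝ ((j : ℕ∞) : WithTop ℕ∞) (fun q : Momentum => Real.cos (m * (WithLp.ofLp q) 0) * Real.cos (n * (WithLp.ofLp q) 1)))
  have hG := ((contDiff_cos_coord n 0).mul (contDiff_cos_coord m 1) :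
    ContDiff ℝ ((j : ℕ∞) : WithTop ℕ∞) (fun q : Momentum => Real.cos (n * (WithLp.ofLp q) 0) * Real.cos (m * (WithLp.ofLp q) 1)))
  have hfun : (fun q : Momentum => TrigPolyC4v.harmonic m n (WithLp.ofLp q)) =
      (1 / 2 : ℝ) • ((fun q : Momentum => Real.cos (m * (WithLp.ofLp q) 0) * Real.cos (n * (WithLp.ofLp q) 1)) +
        (fun q : Momentum => Real.cos (n * (WithLp.ofLp q) 0) * Real.cos (m * (WithLp.ofLp q) 1))) := by
    funext q
    simp only [TrigPolyC4v.harmonic, Pi.smul_apply, Pi.add_apply, smul_eq_mul]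
    ring
  have hFG : ContDiff ℝ ((j : ℕ∞) : WithTop ℕ∞)
      ((fun q : Momentum => Real.cos (m * (WithLp.ofLp q) 0) * Real.cos (n * (WithLp.ofLp q) 1)) +
        (fun q : Momentum => Real.cos (n * (WithLp.ofLp q) 0) * Real.cos (m * (WithLp.ofLp q) 1))) := hF.add hG
  rw [hfun, iteratedFDeriv_const_smul_apply hFG.contDiffAt, iteratedFDeriv_add_apply hF.contDiffAt hG.contDiffAt,
    norm_smul]
  have h1 := norm_iteratedFDeriv_cos_mul_cos_le m n 0 1 j q
  have h2 := norm_iteratedFDeriv_cos_mul_cos_le n m 0 1 j q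
  rw [show ((n : ℝ) + m) = (m : ℝ) + n by ring] at h2
  have h3 := (norm_add_le _ _).trans (add_le_add h1 h2)
  rw [Real.norm_eq_abs, abs_of_pos (by norm_num : (0 : ℝ) < 1 / 2)]
  linarith

/-! ## §3 Frames -/

/-- **ALL-ORDER DERIVATIVE BOUND OF A FRAME FROM ITS COEFFICIENT WEIGHT**: `‖D^j (evalM K)(q)‖ ≤ coeffNorm j K` at every `q`. -/
theorem norm_iteratedFDeriv_evalM_le_coeffNorm (K : TrigPolyC4v) (j : ℕ) (q : Momentum) :
    ‖iteratedFDeriv ℝ j (evalM K) q‖ ≤ K.coeffNorm j := by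
  have hfun : evalM K = fun q : Momentum => ∑ m ∈ range (K.degree + 1),
      (fun q : Momentum => ∑ n ∈ range (K.degree + 1), K.coeff m n * TrigPolyC4v.harmonic m n (WithLp.ofLp q)) q := by
    funext q; simp [evalM, TrigPolyC4v.eval_def]
  have hterm : ∀ m n, ContDiff ℝ ((j : ℕ∞) : WithTop ℕ∞)
      (fun q : Momentum => K.coeff m n * TrigPolyC4v.harmonic m n (WithLp.ofLp q)) := fun m n =>
    contDiff_const.mul (contDiff_harmonicM m n)
  have hrow : ∀ m, ContDiff ℝ ((j : ℕ∞) : WithTop ℕ∞)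
      (fun q : Momentum => ∑ n ∈ range (K.degree + 1), K.coeff m n * TrigPolyC4v.harmonic m n (WithLp.ofLp q)) := fun m =>
    ContDiff.sum fun n _ => hterm m n
  rw [hfun, iteratedFDeriv_fun_sum_apply fun m _ => (hrow m).contDiffAt]
  unfold TrigPolyC4v.coeffNorm
  refine (norm_sum_le _ _).trans (sum_le_sum fun m _ => ?_)
  have hfun' : (fun q : Momentum => ∑ n ∈ range (K.degree + 1), K.coeff m n * TrigPolyC4v.harmonic m n (WithLp.ofLp q)) =
      fun q : Momentum => ∑ n ∈ range (K.degree + 1),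
        (fun q : Momentum => K.coeff m n * TrigPolyC4v.harmonic m n (WithLp.ofLp q)) q := rfl
  rw [hfun', iteratedFDeriv_fun_sum_apply fun n _ => (hterm m n).contDiffAt]
  refine (norm_sum_le _ _).trans (sum_le_sum fun n _ => ?_)
  have hsm : (fun q : Momentum => K.coeff m n * TrigPolyC4v.harmonic m n (WithLp.ofLp q)) =
      K.coeff m n • fun q : Momentum => TrigPolyC4v.harmonic m n (WithLp.ofLp q) := by
    funext q; simp [smul_eq_mul]
  rw [hsm, iteratedFDeriv_const_smul_apply ((contDiff_harmonicM m n (k := ((j : ℕ∞) : WithTop ℕ∞))).contDiffAt), norm_smul,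
    Real.norm_eq_abs, mul_comm]
  refine mul_le_mul_of_nonneg_right ((norm_iteratedFDeriv_harmonicM_le m n j q).trans ?_) (abs_nonneg _)
  exact pow_le_pow_left₀ (by positivity) (by linarith) j

/-- **Derivative bound of a difference of frames**: `‖D^j (evalM (A ⊖ B))(q)‖ ≤ coeffNorm j A + coeffNorm j B`. -/
theorem norm_iteratedFDeriv_evalM_fsub_le (A B : TrigPolyC4v) (j : ℕ) (q : Momentum) :
    ‖iteratedFDeriv ℝ j (evalM (fsub A B)) q‖ ≤ A.coeffNorm j + B.coeffNorm j := by
  have hfun : evalM (fsub A B) = evalM A - evalM B := by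
    funext q; simp [evalM_fsub]
  have hA : ContDiff ℝ ((j : ℕ∞) : WithTop ℕ∞) (evalM A) := contDiff_evalM A
  have hB : ContDiff ℝ ((j : ℕ∞) : WithTop ℕ∞) (evalM B) := contDiff_evalM B
  have hBn : ContDiff ℝ ((j : ℕ∞) : WithTop ℕ∞) (-evalM B) := hB.neg
  rw [hfun, sub_eq_add_neg, iteratedFDeriv_add_apply hA.contDiffAt hBn.contDiffAt, iteratedFDeriv_neg_apply]
  exact (norm_add_le _ _).trans (add_le_add (norm_iteratedFDeriv_evalM_le_coeffNorm A j q)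
    (by rw [norm_neg]; exact norm_iteratedFDeriv_evalM_le_coeffNorm B j q))

end Summit.HubbardSuperconductivity.HubbardSuperconductivity.Theorems.KLRegimeSplit

end
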